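import Summits.QuantumFields.YangMills.Theorems.FiniteRankMirrorDefectPeelingGlue
import HarnessLib

/-!
# Crux `NT` (stmt-QuantumFields-19353): the chirality defect `Q2(θv, v) − MF(v)` vanishes along a unit map under (RM₁) — generic form

Helper file (`--supports stmt-QuantumFields-19353 --as helper`; fleet lead prover of crux `NT`, unit `ym-spine-19353-p1`, g22).  The
route item `FiniteRankMirror.DefectPeelingGlue` (stmt-QuantumFields-23849, closed by `…FiniteRankMirrorDefectPeelingGlue`) packages the
statement below behind the route's pin (a bare mirror floor) and the by-name alias `FemtoResponseLaw`.  Here is the PIN-FREE, route-free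
form other consumers of the chirality defect can cite: for ANY compact `G`, lattice representation `r` and unit map `a → 0⁺` carrying the
singleton response-moment law (RM₁) with range `ℓ₁`, every real Schwartz `v` with `tsupport v ⊆ {y₀ > 0} ∩ B(0, ℓ₁/8)` has
`|Q2_{β,L,aβ}(θv, v) − (E_T[(Ṽ_box∘Θ₀)·Ṽ_box] − E_T[Ṽ_box]²)| ≤ η` eventually in `β` on all tori `Λ₇ ≤ aβ·L`, for every `η > 0`
(`mirrorDefect_eventually_le_of_responseMoments`; same proof as the item: cube family, peeling, `rblΔ_l2_eventually_of_responseMoments`,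
`smear_l2_le_of_responseMoments`).  Located remark: the electric/chirality seam is thus paid by a TYPICAL ONE-POINT law (RM₁), not by
the `∀`-exterior boundary law FBL6 nor by a two-point ceiling (MomentBounds6).

HONEST FRAMING: conditional on (RM₁) (open RG statement, E0′-K class); nothing of NT or the mass gap is proved; not Clay.
-/

set_option autoImplicit false

noncomputable section

open scoped SchwartzMap
open MeasureTheory Filter Topology
open Literature.MathematicalPhysics.QuantumFieldTheory Literature.MathematicalPhysics.QuantumLattice
open Literature.Probability.LatticeModels
open Summit.QuantumFields.YangMills.Cruxes.OSLegsFromFemtoAndGap.DlrCollarTransfer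
open Summit.QuantumFields.YangMills.Cruxes.UVSeamRec.UnitTransfer (exists_time_floor_and_radius)

namespace Summit.QuantumFields.YangMills.Cruxes.FiniteRankMirrorDefectPeeling

variable (G : Type) [Group G] [TopologicalSpace G] [IsTopologicalGroup G] [CompactSpace G]
  [MeasurableSpace G] [BorelSpace G] (r : LatticeRep G)

/-- **The chirality defect vanishes along a unit map under (RM₁)** (pin-free, route-free form of `DefectPeelingGlue`).  A unit map
`a > 0` with `a → 0`; (RM₁) at `a` with reference values `p`, `C₁ > 0`, `B`, `β₁`, range `ℓ₁ > 0`; a real Schwartz `v` with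
`tsupport v ⊆ {y₀ > 0} ∩ B(0, ℓ₁/8)`.  Then for every `η > 0` there are `β₇, Λ₇` with
`|Q2_{β,L,aβ}(θv, v) − (E_T[(Ṽ_box∘Θ₀)·Ṽ_box] − E_T[Ṽ_box]²)| ≤ η` for `β ≥ β₇`, `Λ₇ ≤ aβ·L`. [folklore] -/
theorem mirrorDefect_eventually_le_of_responseMoments (a : ℝ → ℝ) (ha₀ : ∀ β, 0 < a β) (ha : Tendsto a atTop (𝓝 0))
    {C₁ B β₁ ℓ₁ : ℝ} (hC₁ : 0 < C₁) (hℓ₁ : 0 < ℓ₁) (p : Fin 4 × Fin 4 → ℝ → ℝ)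
    (hRM : ∀ β : ℝ, β₁ ≤ β → ∀ (L : ℕ) (q : Fin 4 × Fin 4) (x : Fin 4 → ℤ) (R : ℕ), q.1 < q.2 → 1 ≤ R →
      (R : ℝ) * a β ≤ ℓ₁ → 4 * R + 8 ≤ L →
      torusE G r β L (fun U => Real.exp ((R : ℝ) ^ 4 / C₁ *
        |kerE G r β (fun k => x k - (R + 1)) (2 * R + 3) U (plane G r q x) - p q β|)) ≤ Real.exp B)
    (v : 𝓢(EuclideanSpace ℝ (Fin 4), ℝ)) (hv0 : tsupport (v : EuclideanSpace ℝ (Fin 4) → ℝ) ⊆ {y | 0 < y 0})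
    (hvB : tsupport (v : EuclideanSpace ℝ (Fin 4) → ℝ) ⊆ Metric.closedBall 0 (ℓ₁ / 8)) {η : ℝ} (hη : 0 < η) :
    ∃ (β₇ Λ₇ : ℝ), ∀ β : ℝ, β₇ ≤ β → ∀ L : ℕ, Λ₇ ≤ a β * L →
      |Q2 G r β L (a β) (thetaTest 4 v) v -
          (torusE G r β L (fun V => (∑ y ∈ box 4 L, v (a β • siteToE y) * dens G r y (cfgReflect V)) *
              ∑ y ∈ box 4 L, v (a β • siteToE y) * dens G r y V) -
            torusE G r β L (fun V => ∑ y ∈ box 4 L, v (a β • siteToE y) * dens G r y V) ^ 2)| ≤ η := by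
  -- compact support, time floor
  have hvK : HasCompactSupport (v : EuclideanSpace ℝ (Fin 4) → ℝ) :=
    HasCompactSupport.of_support_subset_isCompact (isCompact_closedBall 0 (ℓ₁ / 8)) ((subset_tsupport _).trans hvB)
  obtain ⟨δ₀, M₀, hδ₀, -, hvT₀⟩ := exists_time_floor_and_radius hvK hv0
  have hvBall : ∀ z, v z ≠ 0 → ‖z‖ ≤ ℓ₁ / 8 := fun z hz => by
    have := hvB (subset_tsupport _ hz)
    rwa [Metric.mem_closedBall, dist_zero_right] at this
  set δ : ℝ := min δ₀ (ℓ₁ / 8) with hδ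
  have hδpos : 0 < δ := lt_min hδ₀ (by positivity)
  have hδℓ : δ ≤ ℓ₁ / 8 := min_le_right _ _
  have hvT : ∀ z, v z ≠ 0 → δ ≤ z 0 := fun z hz => (min_le_left _ _).trans (hvT₀ z hz).1
  -- the cube family
  obtain ⟨β₅, c, b, hadm, hgeom, hfem, hsupp, hthick⟩ :=
    exists_posTimeCubeFamily a ha₀ ha v (by positivity : (0 : ℝ) < ℓ₁ / 8) hδpos hvBall hvT
  have hκ : (0 : ℝ) < δ / 2 := by positivity
  have hfemto : ∀ β, β₅ ≤ β → (b β : ℝ) * a β ≤ ℓ₁ := fun β hβ => by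
    have h1 := hfem β hβ
    have h2 := (hadm β hβ).2
    nlinarith
  -- the two peeling factors along the unit map
  obtain ⟨KV, β₆, hKV, hV⟩ := smear_l2_le_of_responseMoments G r a ha₀ ha v hvK hκ hC₁ hℓ₁ p c b
    (fun β hβ => (hadm β hβ).1) hgeom hfemto hthick hRM
  have hη₁ : 0 < (η / (2 * KV + 2)) ^ 2 := by positivity
  obtain ⟨β₇, hΔ⟩ := NT.MarkovMirror.rblΔ_l2_eventually_of_responseMoments G r a a ha₀ ha v hvK hκ hC₁ hℓ₁ p c b hgeom
    hfemto hsupp hthick hRM hη₁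
  refine ⟨max β₅ (max β₆ β₇), 2 * (3 * (ℓ₁ / 8 + δ / 2) + 14), fun β hβ L hL => ?_⟩
  have hβ₅ : β₅ ≤ β := le_trans (le_max_left _ _) hβ
  have hβ₆ : β₆ ≤ β := le_trans (le_trans (le_max_left _ _) (le_max_right _ _)) hβ
  have hβ₇ : β₇ ≤ β := le_trans (le_trans (le_max_right _ _) (le_max_right _ _)) hβ
  obtain ⟨hc0, hsize⟩ := hgeom β hβ₅
  have hL1 : 3 * (ℓ₁ / 8 + δ / 2) + 14 ≤ a β * L := by nlinarith [hL]
  obtain ⟨hwin, hsub⟩ := window_of_geom (ha₀ β) hsize hL1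
  have hpeel := abs_defect_le_peel G r β L (a β) v (c β) (b β) hc0 hwin hsub (hsupp β hβ₅)
    (∑ x ∈ cubeSites (c β) (b β), (v (a β • siteToE (x + Pi.single 0 1)) - v (a β • siteToE x)) *
      ∑ q : {q : Fin 4 × Fin 4 // q.1 < q.2}, (if q.1.1 = 0 then p q.1 β else 0))
    (∑ y ∈ cubeSites (c β) (b β), v (a β • siteToE y) * ∑ q : {q : Fin 4 × Fin 4 // q.1 < q.2}, p q.1 β)
  exact hpeel.trans (two_mul_sqrt_mul_sqrt_le hKV hη (hΔ β hβ₇ L hL) (hV β hβ₆ L hL))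

end Summit.QuantumFields.YangMills.Cruxes.FiniteRankMirrorDefectPeeling

end
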